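import Summits.ABC.ABC.Theorems.RibetTakahashiSplitManyPrimeValuationProductFreyClassSuffices
import Summits.ABC.ABC.Theorems.AbcValuationProduct

/-!
# Route RibetTakahashiSplit — the consumers of the crux `ManyPrimeValuationProduct` need it only on
# the PRINTED Frey–Hellegouarch class

Consumer analysis, wave 2, for the crux r2 =
`Summit.ABC.ABC.Theses.RibetTakahashiSplit.ManyPrimeValuationProduct` (item stmt-ABC-1561;
`--supports`, line `jl-zero-cycle-height`, stub `stub_fermatInputResidual`).

Wave 1 (`…ManyPrimeValuationProductFreyClassSuffices`) certified that every consumer of r2 in the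
route — the `Assembly` chain through which `RibetTakahashiSplit.closes` runs, glue A
(`SubexpManyPrimesOfValuationProduct`, stmt-ABC-1570) and glue B (`ValuationProductOfCurves`,
stmt-ABC-1571) — needs r2 only on curves `ℚ`-isomorphic to a TWISTED Frey curve
`freyCurve (d a) (d b)`, `a, b` coprime integers, `ab(a+b) ≠ 0`, `d ∣ 2`.  The Jacquet–Langlands
package of the line, however, is printed (Pasten, *Shimura curves and the abc conjecture*, Thm 6.1
(b)) only for the class `Literature.NumberTheory.Automorphic.IsFreyHellegouarch W`:
`∃ (a b : ℕ) C, 0 < a ∧ 0 < b ∧ Nat.Coprime a b ∧ C • W = freyCurve a b` — untwisted, with POSITIVE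
natural parameters.  A crux restricted to this smaller class is a weaker statement, so the wave-1
certificates cannot be fed with it.  This file re-certifies the three consumers for the printed
class (the hypothesis below is `IsFreyHellegouarch W`, unfolded):

* `abc_of_manyPrimeFreyHellegouarchClass` — the Assembly chain (r3′ alone gives `ABC`);
* `subexpManyPrimes_of_manyPrimeFreyHellegouarchClass` — glue A: milestone `SubexpABCManyPrimes`;
* `AbcValuationProduct.of_manyPrimeFreyHellegouarchClass` — glue B: with r4, `AbcValuationProduct`;

together with the def-free bridge that makes this possible:

* `exists_freyHellegouarch_of_smul_eq_freyCurve` — an INTEGER Frey witness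
  `C' • W = freyCurve a b` (`a, b` coprime, `ab(a+b) ≠ 0`, any signs) already puts `W` in the
  printed class: translating `x` by the middle root of `x(x − a)(x + b)` gives
  `x(x − a')(x + b')` with `a', b' > 0` coprime (`{a', b', a'+b'} = {|a|, |b|, |a+b|}`);
* `FreyHellegouarchClassSuffices.exists_freyHellegouarch_model` — the curve the glues attach to an
  abc triple (B–G Ex. 12.5.10, as in wave 1's `FreyClassSuffices.exists_freyCurve_model`, whose
  statement forgets that its twist is `d = 1`) lies in the printed class.

Consequence for the lead's skeleton (rev a4): package (printed class) + lever ⟹ r2 on the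
Frey–Hellegouarch class ⟹ `SubexpABCManyPrimes` (glue A below) and, with r4 and r3′, `ABC`.
(Full-build repair 2026-08-16: glues A, B restated under the names above after the items-cap lint
dropped the route decls `SubexpABCManyPrimes`/`AbcValuationProduct`; old names deprecated aliases.)
-/

-- `Summit.<Summit>.<Problem>` is the mandated summit-side namespace (CONVENTIONS §2); for the
-- single-conjunct summit `ABC` the two coincide, so the duplicate `ABC.ABC` is deliberate.
set_option linter.dupNamespace false

namespace Summit.ABC.ABC.Theorems

open IsDedekindDomain WeierstrassCurve UniqueFactorizationMonoid Rat.HeightOneSpectrum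
open Literature.NumberTheory.EllipticCurves Literature.NumberTheory.DiophantineGeometry
open Summit.ABC.ABC.Theses.RibetTakahashiSplit

/-! ## The bridge: integer Frey witnesses lie in the printed Frey–Hellegouarch class -/

/-- The Frey–Hellegouarch equation depends only on the unordered pair of nonzero roots `{a, −b}`:
`x(x − a)(x + b) = x(x − (−b))(x + (−a))`, i.e. `freyCurve a b = freyCurve (−b) (−a)` on the nose
(`a₂ = b − a`, `a₄ = −ab` are invariant). [folklore] -/
theorem FreyHellegouarchClassSuffices.freyCurve_eq_freyCurve_neg_swap (a b : ℤ) :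
    freyCurve a b = freyCurve (-b) (-a) := by
  ext <;> simp [freyCurve] <;> ring

/-- Translating `x` by the root `a` (`x = x' + a`: the change of variables
`(u, r, s, t) = (1, a, 0, 0)`) carries `y² = x(x − a)(x + b)` (roots `0, a, −b`) to
`y² = x'(x' + a)(x' + a + b)` (roots `0, −a, −(a+b)`), i.e. to `freyCurve (−(a+b)) a`. [folklore] -/
theorem FreyHellegouarchClassSuffices.smul_freyCurve_translate_left (a b : ℤ) :
    (⟨1, (a : ℚ), 0, 0⟩ : VariableChange ℚ) • freyCurve a b = freyCurve (-(a + b)) a := by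
  ext
  · simp [freyCurve, variableChange_a₁]
  · simp [freyCurve, variableChange_a₂]; ring
  · simp [freyCurve, variableChange_a₃]
  · simp [freyCurve, variableChange_a₄]; ring
  · simp [freyCurve, variableChange_a₆]; ring

/-- Translating `x` by the root `−b` (`x = x' − b`: the change of variables
`(u, r, s, t) = (1, −b, 0, 0)`) carries `y² = x(x − a)(x + b)` (roots `0, a, −b`) to
`y² = x'(x' − b)(x' − (a+b))` (roots `0, b, a + b`), i.e. to `freyCurve b (−(a+b))`. [folklore] -/
theorem FreyHellegouarchClassSuffices.smul_freyCurve_translate_right (a b : ℤ) :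
    (⟨1, -(b : ℚ), 0, 0⟩ : VariableChange ℚ) • freyCurve a b = freyCurve b (-(a + b)) := by
  ext
  · simp [freyCurve, variableChange_a₁]
  · simp [freyCurve, variableChange_a₂]; ring
  · simp [freyCurve, variableChange_a₃]
  · simp [freyCurve, variableChange_a₄]; ring
  · simp [freyCurve, variableChange_a₆]; ring

/-- **From an integer Frey witness to a positive one.** If `W` is `ℚ`-isomorphic to
`freyCurve a b` with `a, b` coprime integers and `ab(a+b) ≠ 0`, then `W` is `ℚ`-isomorphic to
`freyCurve a' b'` with `a', b'` coprime POSITIVE integers: translate the middle one of the three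
roots `0, a, −b` of `x(x − a)(x + b)` to `0` (`x ↦ x + r`, `r ∈ {0, a, −b}`, the two translation
lemmas above and `freyCurve a b = freyCurve (−b) (−a)`); the outer roots become `a' > 0 > −b'`
with `{a', b', a'+b'} = {|a|, |b|, |a+b|}`, and `a', b'` are coprime because `a, b` are (explicit
Bézout coefficients). Six sign cases of `(a, b, a+b)`. [folklore] -/
theorem FreyHellegouarchClassSuffices.exists_pos_of_smul_eq_freyCurve {W : WeierstrassCurve ℚ}
    {a b : ℤ} {C' : VariableChange ℚ} (hab : IsCoprime a b) (h0 : a * b * (a + b) ≠ 0)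
    (hW : C' • W = freyCurve a b) :
    ∃ (a' b' : ℤ) (C : VariableChange ℚ), 0 < a' ∧ 0 < b' ∧ IsCoprime a' b' ∧
      C • W = freyCurve a' b' := by
  have ha : a ≠ 0 := fun h => h0 (by rw [h]; ring)
  have hb : b ≠ 0 := fun h => h0 (by rw [h]; ring)
  have hs : a + b ≠ 0 := fun h => h0 (by rw [h]; ring)
  obtain ⟨u, v, huv⟩ := hab
  -- the two translates of `W`'s Frey model
  have hL : ((⟨1, (a : ℚ), 0, 0⟩ : VariableChange ℚ) * C') • W = freyCurve (-(a + b)) a := by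
    rw [mul_smul, hW, FreyHellegouarchClassSuffices.smul_freyCurve_translate_left]
  have hR : ((⟨1, -(b : ℚ), 0, 0⟩ : VariableChange ℚ) * C') • W = freyCurve b (-(a + b)) := by
    rw [mul_smul, hW, FreyHellegouarchClassSuffices.smul_freyCurve_translate_right]
  rcases ha.lt_or_gt with ha | ha <;> rcases hb.lt_or_gt with hb | hb
  · -- `a < 0`, `b < 0`: roots `a < 0 < −b`, no translation
    refine ⟨-b, -a, C', by omega, by omega, ⟨-v, -u, by linear_combination huv⟩, ?_⟩
    rw [hW, FreyHellegouarchClassSuffices.freyCurve_eq_freyCurve_neg_swap]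
  · -- `a < 0 < b`
    rcases hs.lt_or_gt with hs | hs
    · -- roots `a < −b < 0`: translate by `−b`
      exact ⟨b, -(a + b), _, hb, by omega, ⟨v - u, -u, by linear_combination huv⟩, hR⟩
    · -- roots `−b < a < 0`: translate by `a`
      refine ⟨-a, a + b, ⟨1, (a : ℚ), 0, 0⟩ * C', by omega, hs,
        ⟨v - u, v, by linear_combination huv⟩, ?_⟩
      rw [hL, FreyHellegouarchClassSuffices.freyCurve_eq_freyCurve_neg_swap, neg_neg]
  · -- `b < 0 < a`
    rcases hs.lt_or_gt with hs | hs
    · -- roots `0 < a < −b`: translate by `a`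
      exact ⟨-(a + b), a, _, by omega, ha, ⟨-v, u - v, by linear_combination huv⟩, hL⟩
    · -- roots `0 < −b < a`: translate by `−b`
      refine ⟨a + b, -b, ⟨1, -(b : ℚ), 0, 0⟩ * C', hs, by omega,
        ⟨u, u - v, by linear_combination huv⟩, ?_⟩
      rw [hR, FreyHellegouarchClassSuffices.freyCurve_eq_freyCurve_neg_swap, neg_neg]
  · -- `0 < a`, `0 < b`: roots `−b < 0 < a`, no translation
    exact ⟨a, b, C', ha, hb, ⟨u, v, huv⟩, hW⟩

/-- **Bridge: an integer Frey witness puts `W` in the printed Frey–Hellegouarch class.** If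
`C' • W = freyCurve a b` for coprime integers `a, b` with `ab(a+b) ≠ 0` (any signs), then
`C • W = freyCurve a' b'` for some change of variables `C` and coprime natural numbers
`a', b' > 0` — i.e. `W` satisfies `Literature.NumberTheory.Automorphic.IsFreyHellegouarch`
(unfolded), the class on which Pasten's Thm 6.1 (b) is printed: translate `x` by the middle root
of `x(x − a)(x + b)`. [folklore] -/
theorem exists_freyHellegouarch_of_smul_eq_freyCurve :
    ∀ (W : WeierstrassCurve ℚ) (a b : ℤ) (C' : WeierstrassCurve.VariableChange ℚ),
      IsCoprime a b → a * b * (a + b) ≠ 0 →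
      C' • W = Literature.NumberTheory.EllipticCurves.freyCurve a b →
      ∃ (a' b' : ℕ) (C : WeierstrassCurve.VariableChange ℚ), 0 < a' ∧ 0 < b' ∧
        Nat.Coprime a' b' ∧ C • W = Literature.NumberTheory.EllipticCurves.freyCurve a' b' := by
  intro W a b C' hab h0 hW
  obtain ⟨A, B, C, hA, hB, hAB, hC⟩ :=
    FreyHellegouarchClassSuffices.exists_pos_of_smul_eq_freyCurve hab h0 hW
  obtain ⟨a', rfl⟩ := Int.eq_ofNat_of_zero_le hA.le
  obtain ⟨b', rfl⟩ := Int.eq_ofNat_of_zero_le hB.le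
  exact ⟨a', b', C, by exact_mod_cast hA, by exact_mod_cast hB, Nat.isCoprime_iff_coprime.mp hAB,
    hC⟩

/-! ## The Frey curve of an abc triple lies in the printed class -/

-- adapted from Summits/ABC/ABC/Theorems/RibetTakahashiSplitManyPrimeValuationProductFreyClassSuffices.lean
-- (`FreyClassSuffices.exists_freyCurve_model`): same two models, with the untwisted (`d = 1`)
-- witness kept and pushed through the bridge.
/-- **Frey translation with a printed-class witness** (Bombieri–Gubler, Ex. 12.5.10). Every abc
triple `(a, b, c)` carries an elliptic curve `W/ℚ` which is semistable away from `2`, lies in the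
Frey–Hellegouarch class `∃ a' b' : ℕ, C, 0 < a' ∧ 0 < b' ∧ gcd(a', b') = 1 ∧ C • W = freyCurve a' b'`
(Pasten's printed class), has `N_W ∣ 2¹⁰ rad(abc)`, has every odd prime of `abc` among its odd
multiplicative primes, and satisfies `∏_{p ∣ abc} v_p(abc) ≤ 4 · T(W)`: namely
`freyIntModel₂ A B ⊗ ℚ` for Serre's arrangement `(A, B)` if `16 ∣ abc` — isomorphic to
`freyCurve A B` by `x = 4x'`, `y = 8y' + 4x'`, an INTEGER witness, made positive by
`exists_freyHellegouarch_of_smul_eq_freyCurve` — and `freyIntModel a b ⊗ ℚ = freyCurve a b`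
(already positive) otherwise. [cite: BombieriGubler2006, Ex. 12.5.10] -/
theorem FreyHellegouarchClassSuffices.exists_freyHellegouarch_model {a b c : ℕ}
    (h : IsABCTriple a b c) :
    ∃ W : WeierstrassCurve ℚ, W.IsElliptic ∧
      (∀ p : ℕ, p.Prime → p ≠ 2 → ¬ p ^ 2 ∣ W.conductorNorm ℤ) ∧
      (∃ (a' b' : ℕ) (C : VariableChange ℚ), 0 < a' ∧ 0 < b' ∧ Nat.Coprime a' b' ∧
        C • W = freyCurve a' b') ∧
      W.conductorNorm ℤ ∣ 2 ^ 10 * rad a b c ∧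
      (a * b * c).primeFactors.erase 2 ⊆
        (W.conductorNorm ℤ).primeFactors.filter (fun p => p ≠ 2 ∧ ¬ p ^ 2 ∣ W.conductorNorm ℤ) ∧
      ∏ p ∈ (a * b * c).primeFactors, (a * b * c).factorization p ≤
        4 * multiplicativeValuationProduct W := by
  have h' := h
  obtain ⟨ha, hb, habc, hcop⟩ := h'
  have hc : 0 < c := by omega
  have habc0 : a * b * c ≠ 0 := by positivity
  -- the membership statement, from "odd primes of `abc` divide `N`" and semistability away from `2`
  have hmem : ∀ (W : WeierstrassCurve ℚ) [W.IsElliptic],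
      (∀ p : ℕ, p.Prime → p ≠ 2 → ¬ p ^ 2 ∣ W.conductorNorm ℤ) →
      (∀ p ∈ (a * b * c).primeFactors, p ≠ 2 → p ∣ W.conductorNorm ℤ) →
      (a * b * c).primeFactors.erase 2 ⊆ (W.conductorNorm ℤ).primeFactors.filter
        (fun p => p ≠ 2 ∧ ¬ p ^ 2 ∣ W.conductorNorm ℤ) := by
    intro W _ hss hdvd p hp
    rw [Finset.mem_erase] at hp
    have hpp : p.Prime := Nat.prime_of_mem_primeFactors hp.2
    rw [Finset.mem_filter, Nat.mem_primeFactors]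
    exact ⟨⟨hpp, hdvd p hp.2 hp.1, (conductorNorm_pos_holds W).ne'⟩, hp.1, hss p hpp hp.1⟩
  by_cases h16 : 16 ∣ a * b * c
  · -- (12.18) for Serre's arrangement `A ≡ -1 (mod 4)`, `16 ∣ B`
    obtain ⟨A, B, hAB, hA, hB, hprod, -⟩ := exists_arrangement h h16
    have h0 : A * B * (A + B) ≠ 0 := by
      rw [← Int.natAbs_ne_zero, hprod]; exact habc0
    have h4 : 4 ∣ B - A - 1 := by
      have : B - A - 1 = B - (A + 1) := by ring
      rw [this]; exact dvd_sub (dvd_trans (by norm_num) hB) hA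
    have h16' : 16 ∣ A * B := dvd_mul_of_dvd_right hB _
    obtain ⟨hE, hss, hdvd, hN, hle⟩ := ValuationProductOfCurves.freyIntModel₂_package hAB h0 hA hB
    rw [hprod] at hdvd hle hN
    haveI := hE
    refine ⟨(freyIntModel₂ A B).baseChange ℚ, hE, fun p hp _ => hss p hp, ?_, ?_,
      hmem _ (fun p hp _ => hss p hp) hdvd, hle⟩
    · -- the integer witness `⟨2, 0, 1, 0⟩⁻¹ • W = freyCurve A B`, made positive by the bridge
      refine exists_freyHellegouarch_of_smul_eq_freyCurve _ A B
        (⟨Units.mk0 (2 : ℚ) two_ne_zero, 0, 1, 0⟩ : VariableChange ℚ)⁻¹ hAB h0 ?_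
      rw [← smul_freyCurve_eq_baseChange_freyIntModel₂ h4 h16', inv_smul_smul]
    · rw [rad_def]
      exact hN.trans (dvd_mul_left _ _)
  · -- (12.17) with `(A, B) = (a, b)`: already a positive coprime pair
    have hab : IsCoprime (a : ℤ) (b : ℤ) := Nat.isCoprime_iff_coprime.mpr hcop
    have hP : (a : ℤ) * b * (a + b) = ((a * b * c : ℕ) : ℤ) := by rw [← habc]; push_cast; ring
    have h0 : (a : ℤ) * b * (a + b) ≠ 0 := by rw [hP]; exact_mod_cast habc0
    have h16' : ¬ (16 : ℤ) ∣ (a : ℤ) * b * (a + b) := by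
      rw [hP]; exact_mod_cast mt Int.natCast_dvd_natCast.mp h16
    obtain ⟨hE, hss, hdvd, hN, hle⟩ := ValuationProductOfCurves.freyIntModel_package hab h0 h16'
    rw [hP, Int.natAbs_natCast] at hdvd hN hle
    haveI := hE
    refine ⟨(freyIntModel (a : ℤ) b).baseChange ℚ, hE, hss, ?_, by rwa [rad_def], hmem _ hss hdvd,
      hle⟩
    exact ⟨a, b, 1, ha, hb, hcop, by rw [one_smul, baseChange_freyIntModel]⟩

/-! ## The Assembly consumer -/

/-- **The route's deciding chain needs r2 only on the printed Frey–Hellegouarch class** (in fact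
not at all).  The `Assembly` `ManyPrimeValuationProduct → FewPrimeValuationProduct →
WeightedSzpiroBound → ABC` (item stmt-ABC-11012, through which `RibetTakahashiSplit.closes` runs)
remains true when the crux r2 is replaced by its restriction to curves `ℚ`-isomorphic to a
Frey–Hellegouarch curve `freyCurve a b` with `a, b` coprime POSITIVE naturals
(`IsFreyHellegouarch`, the class of Pasten's Thm 6.1 (b)): the weighted Szpiro crux r3′ alone
implies `ABC` (`WeightedSzpiroBound.abc_of`), so neither valuation-product crux is consumed here.
[folklore] -/
theorem abc_of_manyPrimeFreyHellegouarchClass :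
    (∀ ε : ℝ, 0 < ε → ∃ C : ℝ, ∀ (W : WeierstrassCurve ℚ) [W.IsElliptic],
      (∀ p : ℕ, p.Prime → p ≠ 2 → ¬ p ^ 2 ∣ W.conductorNorm ℤ) →
      (∃ (a b : ℕ) (C' : WeierstrassCurve.VariableChange ℚ), 0 < a ∧ 0 < b ∧ Nat.Coprime a b ∧
        C' • W = Literature.NumberTheory.EllipticCurves.freyCurve a b) →
      4 ≤ ((W.conductorNorm ℤ).primeFactors.filter
        (fun p => p ≠ 2 ∧ ¬ p ^ 2 ∣ W.conductorNorm ℤ)).card →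
      ((∏ p ∈ (W.conductorNorm ℤ).primeFactors with ¬ p ^ 2 ∣ W.conductorNorm ℤ,
        (W.minimalDiscriminantNorm ℤ).factorization p : ℕ) : ℝ) ≤
          C * (W.conductorNorm ℤ : ℝ) ^ ε) →
    Summit.ABC.ABC.Theses.RibetTakahashiSplit.FewPrimeValuationProduct →
    Summit.ABC.ABC.Theses.RibetTakahashiSplit.WeightedSzpiroBound → ABC :=
  fun _ _ hW => WeightedSzpiroBound.abc_of hW

/-! ## Glue A on the printed class: the milestone `SubexpABCManyPrimes` -/

-- adapted from Summits/ABC/ABC/Theorems/RibetTakahashiSplitManyPrimeValuationProductFreyClassSuffices.lean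
-- (`subexpABCManyPrimes_of_manyPrimeFreyClass`): verbatim, with the printed-class model.
/-- **Glue A needs r2 only on the printed Frey–Hellegouarch class.** The restriction of
`ManyPrimeValuationProduct` to curves `ℚ`-isomorphic to a Frey–Hellegouarch curve `freyCurve a b`
with `a, b` coprime positive naturals (`IsFreyHellegouarch`) already implies the milestone
`SubexpABCManyPrimes` (stmt-ABC-1568): for an abc triple with `ω(abc) ≥ 5` the curve `W` of
`FreyHellegouarchClassSuffices.exists_freyHellegouarch_model` is in the printed class, semistable
away from `2`, with `≥ 4` odd multiplicative primes, so the restricted crux at `δ = ε/2` gives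
`T(W) ≤ C N^δ ≤ C (2¹⁰ rad)^δ`; and `c ≤ abc ≤ rad(abc)^M` with `M = ∏_{p ∣ abc} v_p(abc) ≤ 4 T(W)`,
so `log c ≤ M log rad ≤ 4 max(C,0) 2^{10δ} rad^δ · rad^δ/δ`. [cite: BombieriGubler2006, Ex. 12.5.10] -/
theorem subexpManyPrimes_of_manyPrimeFreyHellegouarchClass :
    (∀ ε : ℝ, 0 < ε → ∃ C : ℝ, ∀ (W : WeierstrassCurve ℚ) [W.IsElliptic],
      (∀ p : ℕ, p.Prime → p ≠ 2 → ¬ p ^ 2 ∣ W.conductorNorm ℤ) →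
      (∃ (a b : ℕ) (C' : WeierstrassCurve.VariableChange ℚ), 0 < a ∧ 0 < b ∧ Nat.Coprime a b ∧
        C' • W = Literature.NumberTheory.EllipticCurves.freyCurve a b) →
      4 ≤ ((W.conductorNorm ℤ).primeFactors.filter
        (fun p => p ≠ 2 ∧ ¬ p ^ 2 ∣ W.conductorNorm ℤ)).card →
      ((∏ p ∈ (W.conductorNorm ℤ).primeFactors with ¬ p ^ 2 ∣ W.conductorNorm ℤ,
        (W.minimalDiscriminantNorm ℤ).factorization p : ℕ) : ℝ) ≤
          C * (W.conductorNorm ℤ : ℝ) ^ ε) →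
    ∀ ε : ℝ, 0 < ε → ∃ κ : ℝ, ∀ a b c : ℕ, IsABCTriple a b c →
      5 ≤ (a * b * c).primeFactors.card → Real.log c ≤ κ * ((rad a b c : ℕ) : ℝ) ^ ε := by
  intro hF ε hε
  obtain ⟨C, hC⟩ := hF (ε / 2) (half_pos hε)
  set K : ℝ := 4 * max C 0 * ((2 : ℝ) ^ 10) ^ (ε / 2) with hKdef
  have hK0 : 0 ≤ K := by positivity
  refine ⟨K / (ε / 2), fun a b c habc hω => ?_⟩
  obtain ⟨W, hE, hss, hfrey, hN, hsub, hprod⟩ :=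
    FreyHellegouarchClassSuffices.exists_freyHellegouarch_model habc
  haveI := hE
  obtain ⟨ha, hb, hsum, -⟩ := habc
  have hc0 : 0 < c := by omega
  have hn0 : a * b * c ≠ 0 := Nat.mul_ne_zero (Nat.mul_ne_zero ha.ne' hb.ne') hc0.ne'
  -- `≥ 4` odd multiplicative primes
  have h4 : 4 ≤ ((W.conductorNorm ℤ).primeFactors.filter
      (fun p => p ≠ 2 ∧ ¬ p ^ 2 ∣ W.conductorNorm ℤ)).card :=
    calc 4 ≤ (a * b * c).primeFactors.card - 1 := by omega
      _ ≤ ((a * b * c).primeFactors.erase 2).card := Finset.pred_card_le_card_erase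
      _ ≤ _ := Finset.card_le_card hsub
  -- the restricted crux on `W`
  have key : (multiplicativeValuationProduct W : ℝ) ≤ C * (W.conductorNorm ℤ : ℝ) ^ (ε / 2) :=
    hC W hss hfrey h4
  -- `c ≤ abc ≤ rad^M`, `M ≤ 4 T(W)`
  set n : ℕ := a * b * c with hndef
  set M : ℕ := ∏ p ∈ n.primeFactors, n.factorization p with hMdef
  have hcn : c ≤ n := Nat.le_mul_of_pos_left c (Nat.mul_pos ha hb)
  have hcR : c ≤ rad a b c ^ M := by
    rw [rad_def]; exact hcn.trans (le_radical_pow_prod_factorization hn0)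
  set R : ℝ := (rad a b c : ℝ) with hRdef
  have hR1 : (1 : ℝ) ≤ R := by
    rw [hRdef, rad_def]; exact_mod_cast Nat.radical_pos n
  have hR0 : (0 : ℝ) < R := one_pos.trans_le hR1
  have hlogR : 0 ≤ Real.log R := Real.log_nonneg hR1
  have hNR : (W.conductorNorm ℤ : ℝ) ≤ 2 ^ 10 * R := by
    have := Nat.le_of_dvd (mul_pos (by positivity) (by rw [rad_def]; exact Nat.radical_pos _)) hN
    rw [hRdef]; exact_mod_cast this
  -- `M ≤ K R^{ε/2}`
  have hM : (M : ℝ) ≤ K * R ^ (ε / 2) := by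
    calc (M : ℝ) ≤ ((4 * multiplicativeValuationProduct W : ℕ) : ℝ) := by exact_mod_cast hprod
      _ = 4 * (multiplicativeValuationProduct W : ℝ) := by push_cast; ring
      _ ≤ 4 * (C * (W.conductorNorm ℤ : ℝ) ^ (ε / 2)) := by linarith
      _ ≤ 4 * (max C 0 * (W.conductorNorm ℤ : ℝ) ^ (ε / 2)) := by
          gcongr
          exact le_max_left _ _
      _ ≤ 4 * (max C 0 * ((2 : ℝ) ^ 10 * R) ^ (ε / 2)) := by gcongr
      _ = K * R ^ (ε / 2) := by
          rw [hKdef, Real.mul_rpow (by positivity) hR0.le]; ring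
  -- `log c ≤ M log R ≤ K R^{ε/2} · R^{ε/2}/(ε/2)`
  have h1 : Real.log c ≤ (M : ℝ) * Real.log R :=
    calc Real.log c ≤ Real.log (R ^ M) :=
          Real.log_le_log (by exact_mod_cast hc0) (by rw [hRdef]; exact_mod_cast hcR)
      _ = (M : ℝ) * Real.log R := Real.log_pow R M
  have h2 : Real.log R ≤ R ^ (ε / 2) / (ε / 2) := Real.log_le_rpow_div hR0.le (half_pos hε)
  have hKR : 0 ≤ K * R ^ (ε / 2) := by positivity
  calc Real.log c ≤ (M : ℝ) * Real.log R := h1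
    _ ≤ K * R ^ (ε / 2) * Real.log R := mul_le_mul_of_nonneg_right hM hlogR
    _ ≤ K * R ^ (ε / 2) * (R ^ (ε / 2) / (ε / 2)) := mul_le_mul_of_nonneg_left h2 hKR
    _ = K / (ε / 2) * (R ^ (ε / 2) * R ^ (ε / 2)) := by ring
    _ = K / (ε / 2) * R ^ ε := by rw [← Real.rpow_add hR0, add_halves]

/-! ## Glue B on the printed class: the milestone `AbcValuationProduct` -/

-- adapted from Summits/ABC/ABC/Theorems/RibetTakahashiSplitManyPrimeValuationProductFreyClassSuffices.lean
-- (`abcValuationProduct_of_manyPrimeFreyClass`): verbatim, with the printed-class model.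
/-- **Glue B needs r2 only on the printed Frey–Hellegouarch class.** The restriction of
`ManyPrimeValuationProduct` to curves `ℚ`-isomorphic to a Frey–Hellegouarch curve `freyCurve a b`
with `a, b` coprime positive naturals (`IsFreyHellegouarch`), together with the few-prime crux
`FewPrimeValuationProduct` (r4), already implies the milestone `AbcValuationProduct`
(stmt-ABC-1567): the curve `W` of `FreyHellegouarchClassSuffices.exists_freyHellegouarch_model`
is in the printed class and semistable away from `2`, so the restricted r2 (if `W` has `≥ 4` odd
multiplicative primes) or r4 (if `≤ 3`) gives `T(W) ≤ C N^ε ≤ C (2¹⁰ rad)^ε`, and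
`∏_{p ∣ abc} v_p(abc) ≤ 4 T(W)`. [cite: BombieriGubler2006, Ex. 12.5.10] -/
theorem AbcValuationProduct.of_manyPrimeFreyHellegouarchClass :
    (∀ ε : ℝ, 0 < ε → ∃ C : ℝ, ∀ (W : WeierstrassCurve ℚ) [W.IsElliptic],
      (∀ p : ℕ, p.Prime → p ≠ 2 → ¬ p ^ 2 ∣ W.conductorNorm ℤ) →
      (∃ (a b : ℕ) (C' : WeierstrassCurve.VariableChange ℚ), 0 < a ∧ 0 < b ∧ Nat.Coprime a b ∧
        C' • W = Literature.NumberTheory.EllipticCurves.freyCurve a b) →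
      4 ≤ ((W.conductorNorm ℤ).primeFactors.filter
        (fun p => p ≠ 2 ∧ ¬ p ^ 2 ∣ W.conductorNorm ℤ)).card →
      ((∏ p ∈ (W.conductorNorm ℤ).primeFactors with ¬ p ^ 2 ∣ W.conductorNorm ℤ,
        (W.minimalDiscriminantNorm ℤ).factorization p : ℕ) : ℝ) ≤
          C * (W.conductorNorm ℤ : ℝ) ^ ε) →
    Summit.ABC.ABC.Theses.RibetTakahashiSplit.FewPrimeValuationProduct → AbcValuationProduct := by
  intro hF hR4 ε hε
  obtain ⟨C₂, hC₂⟩ := hF ε hε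
  obtain ⟨C₄, hC₄⟩ := hR4 ε hε
  set C : ℝ := max (max C₂ C₄) 0 with hCdef
  have hC0 : 0 ≤ C := le_max_right _ _
  refine ⟨4 * C * ((2 : ℝ) ^ 10) ^ ε, fun a b c h => ?_⟩
  obtain ⟨W, hE, hss, hfrey, hN, -, hprod⟩ :=
    FreyHellegouarchClassSuffices.exists_freyHellegouarch_model h
  haveI := hE
  -- the restricted r2 (the curve is in the printed class) or r4, by the number of odd
  -- multiplicative primes
  have hT : (multiplicativeValuationProduct W : ℝ) ≤ C * (W.conductorNorm ℤ : ℝ) ^ ε := by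
    have hNε : 0 ≤ (W.conductorNorm ℤ : ℝ) ^ ε := by positivity
    rcases le_or_gt 4 ((W.conductorNorm ℤ).primeFactors.filter
        (fun p => p ≠ 2 ∧ ¬ p ^ 2 ∣ W.conductorNorm ℤ)).card with h4 | h3
    · exact (hC₂ W hss hfrey h4).trans (mul_le_mul_of_nonneg_right
        ((le_max_left _ _).trans (le_max_left _ _)) hNε)
    · exact (hC₄ W hss (by omega)).trans (mul_le_mul_of_nonneg_right
        ((le_max_right _ _).trans (le_max_left _ _)) hNε)
  set N : ℝ := ((W.conductorNorm ℤ : ℕ) : ℝ) with hNdef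
  set R : ℝ := ((rad a b c : ℕ) : ℝ) with hRdef
  have hR0 : 0 < R := by
    rw [hRdef, rad_def]; exact_mod_cast Nat.radical_pos _
  have hNR : N ≤ 2 ^ 10 * R := by
    have := Nat.le_of_dvd (mul_pos (by positivity) (by rw [rad_def]; exact Nat.radical_pos _)) hN
    rw [hNdef, hRdef]; exact_mod_cast this
  calc ((∏ p ∈ (a * b * c).primeFactors, (a * b * c).factorization p : ℕ) : ℝ)
      ≤ ((4 * multiplicativeValuationProduct W : ℕ) : ℝ) := by exact_mod_cast hprod
    _ = 4 * (multiplicativeValuationProduct W : ℝ) := by push_cast; ring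
    _ ≤ 4 * (C * N ^ ε) := by gcongr
    _ ≤ 4 * (C * (2 ^ 10 * R) ^ ε) := by gcongr
    _ = 4 * C * ((2 : ℝ) ^ 10) ^ ε * R ^ ε := by
        rw [Real.mul_rpow (by positivity) hR0.le]; ring

/-- Deprecated name (its conclusion was the dropped route decl `SubexpABCManyPrimes`). [folklore] -/
@[deprecated subexpManyPrimes_of_manyPrimeFreyHellegouarchClass (since := "2026-08-16")]
alias subexpABCManyPrimes_of_manyPrimeFreyHellegouarchClass :=
  subexpManyPrimes_of_manyPrimeFreyHellegouarchClass
/-- Deprecated name (its conclusion was the dropped route decl `AbcValuationProduct`). [folklore] -/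
@[deprecated AbcValuationProduct.of_manyPrimeFreyHellegouarchClass (since := "2026-08-16")]
alias abcValuationProduct_of_manyPrimeFreyHellegouarchClass :=
  AbcValuationProduct.of_manyPrimeFreyHellegouarchClass

end Summit.ABC.ABC.Theorems
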